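import Mathlib
import HarnessLib
import Summits.HubbardSuperconductivity.HubbardSuperconductivity.Theorems.KLProgrammeKLRegimeEnginePairTransferMemberRateVariation
import Summits.HubbardSuperconductivity.HubbardSuperconductivity.Theorems.KLProgrammeKLRegimeEnginePairLadderFlowStep

/-!
# Route `KLProgramme` — ENGINE item stmt-HubbardSuperconductivity-20437 `KLRegimeEngineV17F2`, stub (c) value lane, «(c)-OUT» brick (M1):
# THE UN-RESUMMED SLICE INCREMENT OF A MEMBER PAIR ARRAY ON THE MODEL — `‖A(1) − A(0)‖ ≤ ∫‖S‖ + m²·Σ_c klRungProfile`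
# (cell gate-hubbard-kl, seat hubbard-kl-k3c2-p2 g18; door map HOME/hubbard-kl-k3c2-p2/OUT-OF-CLASS-E2.md §1 (i))

WHY.  Out of the pair class (`¬IsPairClassAt Qm (n+1)`) the (E2″-F)ₙ₊₁ increment of the pair amplitude is NOT resummed: along slice `n+1` at a FIXED frame `K`
the member pair array `A(t)` of `klmf_memberArray_flowData` (k3c1-p1, …PairTransferMemberFlow) satisfies `Ȧ = −A·diag ḃ·A + S` with `S` the Riccati defect
(`klmf_riccati_of_defect`), and the plain estimate `‖A(1) − A(0)‖ ≤ ∫₀¹‖S_t‖ + m²·∫₀¹Σ_c‖ḃ_t(c)‖` needs no smallness and no inverse.  k3c1-p1's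
`kltc_increment_of_flow` states exactly this on a PRODUCT carrier `S × F`; the member arrays are `TorusSite 2 L`-indexed (frequencies pinned at `ω₀`), so:
* §1 **`klmf_increment_of_flow`** — the same estimate on ANY finite index type (FTC entrywise + `‖(A·diag ḃ·A)(x,y)‖ ≤ m²·Σ_c‖ḃ(c)‖`; proof = k3c1-p1's, index-generic);
* §2 **`klmf_memberArray_increment_le`** — instantiated on the LITERAL model curves `A, Ȧ` (`klmf_memberArray_flowData`, pass `rfl rfl`) and rungs `b, ḃ` (`klmf_rung_data`),
  any member `ψ`, any frame `K` with `Z^K ≠ 0` on the slice, any a priori size `‖A(t)(x,y)‖ ≤ m` along the slice: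
  `‖A 1 x y − A 0 x y‖ ≤ ∫₀¹‖(Ȧ t + A t·diag(ḃ t)·A t) x y‖dt + m²·∫₀¹Σ_c‖ḃ t c‖dt`
  (`A 1` = ball array of `klCovSmearedPairAmplitude … K (n+1) (softCovOf K ψ)` — at `K = Kₙ₊₁`, `ψ = 0` the PLAIN ball array `klPairArrayF … (n+1) Qm` by
  `klmf_ballArray_succ_eq_klMemberArrayF` + `klMemberArrayF_zero`; `A 0` = ball array of the scale-`n` amplitude smeared with `softCovOf K (ψ + s_{n,n+1})`);
* §3 **`klmf_integral_sum_norm_rate_le_sum_klRungProfile`** — `∫₀¹Σ_c‖ḃ t c‖dt ≤ Σ_c klRungProfile … n ψ Qm c` (swap `∫`/`Σ`, row 57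
  `klmf_integral_norm_rate_le_klRungProfile` termwise; `0 ≤ ψ`), and the composite **`klmf_memberArray_increment_le_rungProfile`**:
  `‖A 1 x y − A 0 x y‖ ≤ ∫₀¹‖S t x y‖dt + m²·Σ_c klRungProfile … n ψ Qm c` — whose pp term `…PairTransferRungTwoShellBooking.rung_mass_le_ppGain_klEngGeo11_all`
  (p640922) books into `(Klam U)²·klEngGeo11.ppGain (n+1) |p_Qm|_𝕋` out of the pair class (index form `ψ = s_{n+1,j}`).
Exact calculus over landed lemmas; nothing about the model's SIZES is asserted (the a priori `m` and the source majorants are the closer's rows); nothing asserts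
(E2″-F), (c), K3 or superconductivity.  0 kit · 0 lit.
-/

noncomputable section

namespace Summit.HubbardSuperconductivity.HubbardSuperconductivity.Theorems.KLRegimeSplit

set_option linter.dupNamespace false -- summit = problem name (single-conjunct summit), D-0017

open Finset Matrix Set Literature.MathematicalPhysics.QuantumLattice Literature.Probability.LatticeModels GrassmannAlgebra
open Summit.HubbardSuperconductivity.HubbardSuperconductivity.Theorems.KLProgrammeLegKernels
open Summit.HubbardSuperconductivity.HubbardSuperconductivity.Theorems.DispersionFlow
open Summit.HubbardSuperconductivity.HubbardSuperconductivity.Theorems.KLRegimeWick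
open scoped Topology

/-! ## §1 The un-resummed increment of a Riccati-type flow on any finite carrier -/

section Generic

variable {ι : Type*} [Fintype ι] [DecidableEq ι]

/-- **Increment of a flow `Γ̇ = −Γ·diag ḃ·Γ + X` on any finite carrier, without resummation** (index-generic twin of k3c1-p1's `kltc_increment_of_flow`):
from the entrywise derivative data on `[0,1]`, continuity of `Γ̇` and `ḃ`, the defect equation `X = Γ̇ + Γ·diag ḃ·Γ` and an a priori bound `‖Γ(t)(x,y)‖ ≤ m`:
`‖Γ(1)(x,y) − Γ(0)(x,y)‖ ≤ ∫₀¹‖X(t)(x,y)‖dt + m²·∫₀¹ Σ_c‖ḃ(t)_c‖dt`. -/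
theorem klmf_increment_of_flow (Γ Γ' X : ℝ → Matrix ι ι ℂ) (b' : ℝ → ι → ℂ) {m : ℝ} (hm : 0 ≤ m)
    (hΓ : ∀ t ∈ Icc (0 : ℝ) 1, ∀ x y, HasDerivAt (fun s => Γ s x y) (Γ' t x y) t)
    (hΓ'c : ∀ x y, ContinuousOn (fun t => Γ' t x y) (Icc 0 1)) (hb'c : ∀ a, ContinuousOn (fun t => b' t a) (Icc 0 1))
    (hX : ∀ t ∈ Icc (0 : ℝ) 1, X t = Γ' t + Γ t * diagonal (b' t) * Γ t)
    (hΓm : ∀ t ∈ Icc (0 : ℝ) 1, ∀ x y, ‖Γ t x y‖ ≤ m) (x y : ι) :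
    ‖Γ 1 x y - Γ 0 x y‖ ≤ (∫ t in (0 : ℝ)..1, ‖X t x y‖) + m ^ 2 * ∫ t in (0 : ℝ)..1, ∑ c, ‖b' t c‖ := by
  have hsub : uIcc (0 : ℝ) 1 ⊆ Icc (0 : ℝ) 1 := by rw [Set.uIcc_of_le zero_le_one]
  have hΓc : ∀ x y, ContinuousOn (fun t => Γ t x y) (Icc 0 1) := fun x y t ht => (hΓ t ht x y).continuousAt.continuousWithinAt
  have hGd : ContinuousOn (fun t => (Γ t * diagonal (b' t) * Γ t) x y) (Icc 0 1) := by
    have h : ∀ t, (Γ t * diagonal (b' t) * Γ t) x y = ∑ a, Γ t x a * b' t a * Γ t a y := fun t => klli_mul_diag_mul_apply _ _ _ _ _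
    simp_rw [h]
    exact continuousOn_finsetSum _ fun a _ => ((hΓc x a).mul (hb'c a)).mul (hΓc a y)
  have hXc : ContinuousOn (fun t => X t x y) (Icc 0 1) := by
    have h : ∀ t ∈ Icc (0 : ℝ) 1, X t x y = Γ' t x y + (Γ t * diagonal (b' t) * Γ t) x y := fun t ht => by
      rw [hX t ht, Matrix.add_apply]
    exact ((hΓ'c x y).add hGd).congr h
  have hBc : ContinuousOn (fun t => ∑ c, ‖b' t c‖) (Icc 0 1) := continuousOn_finsetSum _ fun c _ => (hb'c c).norm
  have hXint : IntervalIntegrable (fun t => X t x y) MeasureTheory.volume 0 1 := (hXc.mono hsub).intervalIntegrable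
  have hBint : IntervalIntegrable (fun t => ∑ c, ‖b' t c‖) MeasureTheory.volume 0 1 := (hBc.mono hsub).intervalIntegrable
  -- FTC
  have hFTC : (∫ t in (0 : ℝ)..1, Γ' t x y) = Γ 1 x y - Γ 0 x y :=
    intervalIntegral.integral_eq_sub_of_hasDerivAt (fun t ht => hΓ t (hsub ht) x y) ((hΓ'c x y).mono hsub).intervalIntegrable
  have hid : Γ 1 x y - Γ 0 x y = ∫ t in (0 : ℝ)..1, (X t x y - (Γ t * diagonal (b' t) * Γ t) x y) := by
    rw [← hFTC]
    refine intervalIntegral.integral_congr fun t ht => ?_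
    have hXt := congrArg (fun M : Matrix ι ι ℂ => M x y) (hX t (hsub ht))
    simp only [Matrix.add_apply] at hXt
    rw [hXt]; ring
  rw [hid]
  have hg : IntervalIntegrable (fun t => ‖X t x y‖ + m ^ 2 * ∑ c, ‖b' t c‖) MeasureTheory.volume 0 1 :=
    hXint.norm.add (hBint.const_mul _)
  refine (intervalIntegral.norm_integral_le_of_norm_le zero_le_one ?_ hg).trans (le_of_eq ?_)
  · refine Filter.Eventually.of_forall fun t ht => ?_
    have ht' : t ∈ Icc (0 : ℝ) 1 := ⟨ht.1.le, ht.2⟩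
    have hG : ‖(Γ t * diagonal (b' t) * Γ t) x y‖ ≤ m ^ 2 * ∑ c, ‖b' t c‖ := by
      refine (klell_norm_mul_diag_mul_apply_le (Γ t) (Γ t) (b' t) x y).trans ?_
      rw [mul_sum]
      exact sum_le_sum fun c _ => by
        calc ‖Γ t x c‖ * ‖b' t c‖ * ‖Γ t c y‖ ≤ m * ‖b' t c‖ * m :=
              mul_le_mul (mul_le_mul_of_nonneg_right (hΓm t ht' x c) (norm_nonneg _)) (hΓm t ht' c y) (norm_nonneg _)
                (mul_nonneg hm (norm_nonneg _))
          _ = m ^ 2 * ‖b' t c‖ := by ring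
    calc ‖X t x y - (Γ t * diagonal (b' t) * Γ t) x y‖ ≤ ‖X t x y‖ + ‖(Γ t * diagonal (b' t) * Γ t) x y‖ := norm_sub_le _ _
      _ ≤ ‖X t x y‖ + m ^ 2 * ∑ c, ‖b' t c‖ := by linarith
  · rw [intervalIntegral.integral_add hXint.norm (hBint.const_mul _), intervalIntegral.integral_const_mul]

end Generic

/-! ## §2 The member pair array along slice `n+1`: the un-resummed increment on the model -/

section Model

variable (L M : ℕ) [NeZero L] [NeZero M] (β U μ : ℝ) (K : TrigPolyC4v)

/-- **THE UN-RESUMMED INCREMENT OF A MEMBER PAIR ARRAY ALONG SLICE `n+1`** (frame `K` with `Z^K ≠ 0` on the slice, member `ψ`, total momentum `Qm`; `A, Ȧ` the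
literal curves of `klmf_memberArray_flowData`, `b, ḃ` those of `klmf_rung_data` — pass `rfl` four times; `‖A(t)(x,y)‖ ≤ m` on `[0,1]`):
`‖A 1 x y − A 0 x y‖ ≤ ∫₀¹‖(Ȧ t + A t·diag(ḃ t)·A t) x y‖dt + m²·∫₀¹Σ_c‖ḃ t c‖dt`. -/
theorem klmf_memberArray_increment_le (n : ℕ) (ψ : FreqMomentum L M → ℝ) (Qm : TorusSite 2 L)
    (hZ : ∀ Λ ∈ Icc (klScale klE0 (n + 1)) (klScale klE0 n), hubbardEffPartitionFnCT L M β U μ 0 K Λ ≠ 0)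
    (A A' : ℝ → Matrix (TorusSite 2 L) (TorusSite 2 L) ℂ)
    (hAdef : A = fun t => Matrix.of fun k k' : TorusSite 2 L => if k ∈ klBall L μ 0 ∧ k' ∈ klBall L μ 0 then
      vertexFn L M β (gaussConv ℂ
        (softCovOf L M β μ K ψ + hubbardCovAboveCT L M β μ 0 K (klScale klE0 (n + 1)) -
          hubbardCovAboveCT L M β μ 0 K (klScale klE0 n + t * (klScale klE0 (n + 1) - klScale klE0 n)))
        (hubbardEffectiveActionCT L M β U μ 0 K (klScale klE0 n + t * (klScale klE0 (n + 1) - klScale klE0 n)))) 4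
        ![(((omega0 M, k'), 0), 0), ((((omega0 M).rev, Qm - k'), 1), 0), ((((omega0 M).rev, Qm - k), 1), 1), (((omega0 M, k), 0), 1)]
      else 0)
    (hA'def : A' = fun t => Matrix.of fun k k' : TorusSite 2 L => if k ∈ klBall L μ 0 ∧ k' ∈ klBall L μ 0 then
      (klScale klE0 (n + 1) - klScale klE0 n) • -((2 : ℂ)⁻¹ * vertexFn L M β (gaussConv ℂ
        (softCovOf L M β μ K ψ + hubbardCovAboveCT L M β μ 0 K (klScale klE0 (n + 1)) -
          hubbardCovAboveCT L M β μ 0 K (klScale klE0 n + t * (klScale klE0 (n + 1) - klScale klE0 n)))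
        (grassmannDerivPairing ℂ
          (Matrix.of fun X Y : HubbardFieldIdx L M => deriv (fun Λ'' : ℝ => hubbardCovAboveCT L M β μ 0 K Λ'' X Y)
            (klScale klE0 n + t * (klScale klE0 (n + 1) - klScale klE0 n)))
          (hubbardEffectiveActionCT L M β U μ 0 K (klScale klE0 n + t * (klScale klE0 (n + 1) - klScale klE0 n)))
          (hubbardEffectiveActionCT L M β U μ 0 K (klScale klE0 n + t * (klScale klE0 (n + 1) - klScale klE0 n))))) 4
        ![(((omega0 M, k'), 0), 0), ((((omega0 M).rev, Qm - k'), 1), 0), ((((omega0 M).rev, Qm - k), 1), 1), (((omega0 M, k), 0), 1)])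
      else 0)
    (b b' : ℝ → TorusSite 2 L → ℂ)
    (hbdef : b = fun t p => -((klBubbleMass L M β μ K
        (fun k => ψ k + (hubbardCutoffWeightCT L M β μ K (klScale klE0 (n + 1)) k -
          hubbardCutoffWeightCT L M β μ K (klScale klE0 n + t * (klScale klE0 (n + 1) - klScale klE0 n)) k))
        (fun k => ψ k + (hubbardCutoffWeightCT L M β μ K (klScale klE0 (n + 1)) k -
          hubbardCutoffWeightCT L M β μ K (klScale klE0 n + t * (klScale klE0 (n + 1) - klScale klE0 n)) k)) Qm p : ℝ) : ℂ))
    (hb'def : b' = fun t p => (((klScale klE0 (n + 1) - klScale klE0 n) *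
        (klBubbleMass L M β μ K
            (fun k => deriv (fun Λ' => hubbardCutoffWeightCT L M β μ K Λ' k) (klScale klE0 n + t * (klScale klE0 (n + 1) - klScale klE0 n)))
            (fun k => ψ k + (hubbardCutoffWeightCT L M β μ K (klScale klE0 (n + 1)) k -
              hubbardCutoffWeightCT L M β μ K (klScale klE0 n + t * (klScale klE0 (n + 1) - klScale klE0 n)) k)) Qm p +
          klBubbleMass L M β μ K
            (fun k => ψ k + (hubbardCutoffWeightCT L M β μ K (klScale klE0 (n + 1)) k -
              hubbardCutoffWeightCT L M β μ K (klScale klE0 n + t * (klScale klE0 (n + 1) - klScale klE0 n)) k))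
            (fun k => deriv (fun Λ' => hubbardCutoffWeightCT L M β μ K Λ' k) (klScale klE0 n + t * (klScale klE0 (n + 1) - klScale klE0 n)))
            Qm p) : ℝ) : ℂ))
    {m : ℝ} (hm : 0 ≤ m) (hAm : ∀ t ∈ Icc (0 : ℝ) 1, ∀ x y, ‖A t x y‖ ≤ m) (x y : TorusSite 2 L) :
    ‖A 1 x y - A 0 x y‖ ≤
      (∫ t in (0 : ℝ)..1, ‖(A' t + A t * diagonal (b' t) * A t) x y‖) + m ^ 2 * ∫ t in (0 : ℝ)..1, ∑ c, ‖b' t c‖ := by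
  obtain ⟨hdA, hA'c, -, -⟩ := klmf_memberArray_flowData L M β U μ K n ψ Qm hZ A A' hAdef hA'def
  obtain ⟨-, hb'c, -⟩ := klmf_rung_data L M β μ K n ψ Qm b b' hbdef hb'def
  exact klmf_increment_of_flow A A' (fun t => A' t + A t * diagonal (b' t) * A t) b' hm hdA hA'c hb'c (fun t _ => rfl) hAm x y

end Model

/-! ## §3 The pp term against the rung profile -/

section Rung

variable {L M : ℕ} [NeZero L] [NeZero M] (β μ : ℝ) (K : TrigPolyC4v)

/-- **The integrated rung-rate mass is below the rung profile's total**: `∫₀¹Σ_c‖ḃ t c‖dt ≤ Σ_c klRungProfile … n ψ Qm c` (`0 < β`, `0 ≤ ψ`; row 57 termwise). -/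
theorem klmf_integral_sum_norm_rate_le_sum_klRungProfile (hβ : 0 < β) (n : ℕ) {ψ : FreqMomentum L M → ℝ} (hψ : ∀ k, 0 ≤ ψ k)
    (Qm : TorusSite 2 L) (b' : ℝ → TorusSite 2 L → ℂ)
    (hb'def : b' = fun t p => (((klScale klE0 (n + 1) - klScale klE0 n) *
        (klBubbleMass L M β μ K
            (fun k => deriv (fun Λ' => hubbardCutoffWeightCT L M β μ K Λ' k) (klScale klE0 n + t * (klScale klE0 (n + 1) - klScale klE0 n)))
            (fun k => ψ k + (hubbardCutoffWeightCT L M β μ K (klScale klE0 (n + 1)) k -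
              hubbardCutoffWeightCT L M β μ K (klScale klE0 n + t * (klScale klE0 (n + 1) - klScale klE0 n)) k)) Qm p +
          klBubbleMass L M β μ K
            (fun k => ψ k + (hubbardCutoffWeightCT L M β μ K (klScale klE0 (n + 1)) k -
              hubbardCutoffWeightCT L M β μ K (klScale klE0 n + t * (klScale klE0 (n + 1) - klScale klE0 n)) k))
            (fun k => deriv (fun Λ' => hubbardCutoffWeightCT L M β μ K Λ' k) (klScale klE0 n + t * (klScale klE0 (n + 1) - klScale klE0 n)))
            Qm p) : ℝ) : ℂ)) :
    (∫ t in (0 : ℝ)..1, ∑ c, ‖b' t c‖) ≤ ∑ c, klRungProfile L M β μ K n ψ Qm c := by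
  -- continuity of every rung rate (from `klmf_rung_data`, with the matching `b`)
  obtain ⟨-, hb'c, -⟩ := klmf_rung_data L M β μ K n ψ Qm _ b' rfl hb'def
  have hsub : uIcc (0 : ℝ) 1 ⊆ Icc (0 : ℝ) 1 := by rw [Set.uIcc_of_le zero_le_one]
  have hint : ∀ c ∈ (univ : Finset (TorusSite 2 L)), IntervalIntegrable (fun t => ‖b' t c‖) MeasureTheory.volume 0 1 :=
    fun c _ => ((hb'c c).norm.mono hsub).intervalIntegrable
  rw [intervalIntegral.integral_finsetSum hint]
  exact Finset.sum_le_sum fun c _ => klmf_integral_norm_rate_le_klRungProfile β μ K hβ n hψ Qm c b' hb'def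

variable (L M) (U : ℝ)

/-- **COMPOSITE**: the un-resummed member increment with the pp term read through the rung profile —
`‖A 1 x y − A 0 x y‖ ≤ ∫₀¹‖S t x y‖dt + m²·Σ_c klRungProfile … n ψ Qm c` (`S = Ȧ + A·diag ḃ·A`, `0 ≤ ψ`, `0 < β`). -/
theorem klmf_memberArray_increment_le_rungProfile (hβ : 0 < β) (n : ℕ) {ψ : FreqMomentum L M → ℝ} (hψ : ∀ k, 0 ≤ ψ k) (Qm : TorusSite 2 L)
    (hZ : ∀ Λ ∈ Icc (klScale klE0 (n + 1)) (klScale klE0 n), hubbardEffPartitionFnCT L M β U μ 0 K Λ ≠ 0)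
    (A A' : ℝ → Matrix (TorusSite 2 L) (TorusSite 2 L) ℂ)
    (hAdef : A = fun t => Matrix.of fun k k' : TorusSite 2 L => if k ∈ klBall L μ 0 ∧ k' ∈ klBall L μ 0 then
      vertexFn L M β (gaussConv ℂ
        (softCovOf L M β μ K ψ + hubbardCovAboveCT L M β μ 0 K (klScale klE0 (n + 1)) -
          hubbardCovAboveCT L M β μ 0 K (klScale klE0 n + t * (klScale klE0 (n + 1) - klScale klE0 n)))
        (hubbardEffectiveActionCT L M β U μ 0 K (klScale klE0 n + t * (klScale klE0 (n + 1) - klScale klE0 n)))) 4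
        ![(((omega0 M, k'), 0), 0), ((((omega0 M).rev, Qm - k'), 1), 0), ((((omega0 M).rev, Qm - k), 1), 1), (((omega0 M, k), 0), 1)]
      else 0)
    (hA'def : A' = fun t => Matrix.of fun k k' : TorusSite 2 L => if k ∈ klBall L μ 0 ∧ k' ∈ klBall L μ 0 then
      (klScale klE0 (n + 1) - klScale klE0 n) • -((2 : ℂ)⁻¹ * vertexFn L M β (gaussConv ℂ
        (softCovOf L M β μ K ψ + hubbardCovAboveCT L M β μ 0 K (klScale klE0 (n + 1)) -
          hubbardCovAboveCT L M β μ 0 K (klScale klE0 n + t * (klScale klE0 (n + 1) - klScale klE0 n)))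
        (grassmannDerivPairing ℂ
          (Matrix.of fun X Y : HubbardFieldIdx L M => deriv (fun Λ'' : ℝ => hubbardCovAboveCT L M β μ 0 K Λ'' X Y)
            (klScale klE0 n + t * (klScale klE0 (n + 1) - klScale klE0 n)))
          (hubbardEffectiveActionCT L M β U μ 0 K (klScale klE0 n + t * (klScale klE0 (n + 1) - klScale klE0 n)))
          (hubbardEffectiveActionCT L M β U μ 0 K (klScale klE0 n + t * (klScale klE0 (n + 1) - klScale klE0 n))))) 4
        ![(((omega0 M, k'), 0), 0), ((((omega0 M).rev, Qm - k'), 1), 0), ((((omega0 M).rev, Qm - k), 1), 1), (((omega0 M, k), 0), 1)])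
      else 0)
    (b' : ℝ → TorusSite 2 L → ℂ)
    (hb'def : b' = fun t p => (((klScale klE0 (n + 1) - klScale klE0 n) *
        (klBubbleMass L M β μ K
            (fun k => deriv (fun Λ' => hubbardCutoffWeightCT L M β μ K Λ' k) (klScale klE0 n + t * (klScale klE0 (n + 1) - klScale klE0 n)))
            (fun k => ψ k + (hubbardCutoffWeightCT L M β μ K (klScale klE0 (n + 1)) k -
              hubbardCutoffWeightCT L M β μ K (klScale klE0 n + t * (klScale klE0 (n + 1) - klScale klE0 n)) k)) Qm p +
          klBubbleMass L M β μ K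
            (fun k => ψ k + (hubbardCutoffWeightCT L M β μ K (klScale klE0 (n + 1)) k -
              hubbardCutoffWeightCT L M β μ K (klScale klE0 n + t * (klScale klE0 (n + 1) - klScale klE0 n)) k))
            (fun k => deriv (fun Λ' => hubbardCutoffWeightCT L M β μ K Λ' k) (klScale klE0 n + t * (klScale klE0 (n + 1) - klScale klE0 n)))
            Qm p) : ℝ) : ℂ))
    (S : ℝ → Matrix (TorusSite 2 L) (TorusSite 2 L) ℂ) (hS : ∀ t ∈ Icc (0 : ℝ) 1, S t = A' t + A t * diagonal (b' t) * A t)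
    {m : ℝ} (hm : 0 ≤ m) (hAm : ∀ t ∈ Icc (0 : ℝ) 1, ∀ x y, ‖A t x y‖ ≤ m) (x y : TorusSite 2 L) :
    ‖A 1 x y - A 0 x y‖ ≤ (∫ t in (0 : ℝ)..1, ‖S t x y‖) + m ^ 2 * ∑ c, klRungProfile L M β μ K n ψ Qm c := by
  have h1 := klmf_memberArray_increment_le L M β U μ K n ψ Qm hZ A A' hAdef hA'def _ b' rfl hb'def hm hAm x y
  have h2 := klmf_integral_sum_norm_rate_le_sum_klRungProfile β μ K hβ n hψ Qm b' hb'def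
  have hS' : (∫ t in (0 : ℝ)..1, ‖(A' t + A t * diagonal (b' t) * A t) x y‖) = ∫ t in (0 : ℝ)..1, ‖S t x y‖ :=
    intervalIntegral.integral_congr fun t ht => by
      have ht' : t ∈ Icc (0 : ℝ) 1 := by rwa [Set.uIcc_of_le zero_le_one] at ht
      simp only [hS t ht']
  rw [hS'] at h1
  exact h1.trans (by nlinarith [sq_nonneg m])

end Rung

end Summit.HubbardSuperconductivity.HubbardSuperconductivity.Theorems.KLRegimeSplit

end
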